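import Summits.QuantumFields.YangMills.Theorems.BalabanUVNodesN15AnyPropagatorSandwichLetters
import Summits.QuantumFields.YangMills.Theorems.BalabanUVNodesN15SmallFieldSiteLayerCovariant
import HarnessLib

/-!
# N15 = NE2 — PROGRAMME 𝟙P «ONE PROPAGATOR», part (𝟙P-c): ★★★ THE SITE LAYER OF dag-n15-c's SMALL-FIELD FAMILY FOR ANY INNER PROPAGATOR FAMILY WITH THREE DISPLAYED ROWS — `NE2PlusSite` BY NAME
# for the U-live site kernel whose sandwich `(Q⊗1 + D(A′)) X(A′) (Q*⊗1 + E(A′))` reads an ARBITRARY propagator family `X(A′)` (rows: increment size `K_X·(c₃₅L^mα₀)`, two-grid defect `K_X·(L^k)^{−1∕16}`)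
# (dag-n15-a g32, FILE (𝟙P-c); node N15 = NE2; `--supports stmt-QuantumFields-27366 --as helper`, count-neutral; one plumbing `def` + theorems; imports (𝟙P-b), (Q-3))

WHY.  [B9] Thm 3.2 (3.48) p.398 reads the SAME propagator `G(U)` as Thm 3.1 («Under the assumptions of Theorem 3.1, and with the same constants …»).  (Q-3) `ne2PlusSite_foSiteCov` proved the
tree's site template for the sandwich `(Q⊗1 + D) X (Q*⊗1 + E)` with `X` HARD-WIRED to dag-n15-c's FILE 133 propagator (covariant averaging summand flat inside), while the operator layer of the
road-(c) literal (193b `ne2PlusOperator_sfq₄`) reads their `X_q` (summand live) — LOCATED-X.  This file proves the site template for EVERY inner propagator family `(Xc i A′, Xf i A′)` whose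
increments over the flat zero-field pair carry, under `Reg335 c₃₅ α₀ A′` in a small-field window `c₃₅L^mα₀ ≤ s_X` on cubes `L^m ≥ w_X`, the THREE rows of (𝟙P-b) with amplitudes `K_X·(c₃₅L^mα₀)`
(size, both spacings — [B9] (3.62)–(3.65)'s «`G(U) − G(1) = O(field)`» shape) and `K_X·(L^k)^{−1∕16}` (two-grid defect of the increments) at some rate `ρ_X > 0` — next to (Q-3)'s displayed
rows of the averaging perturbation family.  Instances: FILE 133's `X` with (I-b)∕(I-c) ((𝟙P-e′), so (Q-3)'s theorem is the special case); dag-n15-c's `X_q` with (𝟙P-e).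

WHAT.  §1 def `foSiteAny … Xc Xf Dc Ec Df Ef i` (fine `siteC` at `zAnyF (Xf i A′) (Df i A′) (Ef i A′)` minus coarse `siteC` at `zAnyC (Xc i A′) (Dc i A′) (Ec i A′)`), `foSiteAny_ker`, ★ `foSiteAny_cvGlued`
(at FILE 133's propagator family the kernel IS (Q-3)'s `foSiteCov`, pointwise — (𝟙P-a) `zCovC_eq_zAnyC`).  §2 ★★★ **`ne2PlusSite_foSiteAny`**: odd `L ≥ 7`, `a, c₃₅ > 0`, `ι` nonempty, a propagator
family with the three displayed rows (`hX`) and a perturbation family with (Q-3)'s six displayed rows (`hfam`) ⟹ `NE2PlusSite d′ p c₃₅ (sfInstance d mm ι hL) (foSiteAny … Xc Xf Dc Ec Df Ef)` for all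
`α β j j′ d′ p`; constants `(M₅, δ, a₀, C, γ) = (max(w_X,1), δ_S, a₀(K_X, K_D), C_S(K(K_X + 3 + 2K_D) + 1) + 1, 1∕16)`; (Q-3)'s proof with (𝟙P-b) `exists_zAny_letters` — NO trace-form hypothesis,
NO FILE 133 regime (they live in the rows).  NON-VACUITY: FILE 133's propagator family meets `hX` — (𝟙P-e′) `…FlatSummandPropagatorRows` (`rows_cvGlued`, from (I-b)∕(I-c)); dag-n15-c's `X_q` — (𝟙P-e).

HONEST FRAMING ∕ LIMITS.  The inner propagator and the covariant averaging are DISPLAYED by rows — no propagator constructed here, [5] (124) not typed; MODEL carriers of dag-n15-c (two-spacing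
glued doubled torus `sfInstance`, global small-field gauge `u ≡ 1`, `Reg336` idle, King-block-mean pairing, `L ≥ 7`, `M₅ ≤ L^m` = print's «M ≥ M₁», crude constants); the η-rate inequality itself is
NOT PRINTED ([B9] Thm 3.14 = domain differences); (3.48) reads `G′²`, the model `X`.  NOT [B9] Thm 3.2 AS PRINTED.  No layer knit here; N15 stays DISCHARGED OF RECORD 8∕28 AS CONSUMED (U-blind
v7 pin, p687738) — no re-pin asked, nothing re-claimed, no count moved; K3⁸ OPEN; finite 𝕋⁴ per index — NOT ℝ⁴ ∕ OS ∕ mass gap ∕ Clay.  One plumbing `def` ⇒ review ∕ audit lane.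
`set_option maxHeartbeats 800000 in` ×1 ((Q-3)'s budget).  No `sorry`, `instance`, `notation`; standard axioms.
[cite: Balaban1985BackgroundPropagators, Thm 3.2 (3.48) p.398 («with the same constants») + (3.132) p.422 + Thm 3.14 pp.426–427 (quantifier template, shapes), (3.62)–(3.65) pp.402–403, (3.78)–(3.81) p.406, (3.35) p.396;
Balaban1984PropagatorsI, (1.66) p.29, (1.102)–(1.103) p.34; King1986, Lemma 4.5 (4.38)–(4.41) pp.674–675 (mechanism); CombesThomas1973, §II (mechanism)]
-/

noncomputable section

open scoped BigOperators Matrix Matrix.Norms.Frobenius Kronecker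

namespace Summit.QuantumFields.YangMills.BalabanUVNodes.N15.SiteLayerSf

open Literature.MathematicalPhysics.QuantumFieldTheory.Balaban1983to89
open Literature.MathematicalPhysics.QuantumFieldTheory.King1986 (exp_decay_mono)
open Literature.MathematicalPhysics.QuantumFieldTheory.Balaban1983to89.T4EtaRate (PairedInstance NE2PlusSite EtaRateIneqSite rateFactor)
open Literature.MathematicalPhysics.QuantumFieldTheory.Balaban1983to89.T4EtaRateDefect (rateWeight idef)
open Literature.MathematicalPhysics.QuantumFieldTheory.Balaban1983to89.T4EtaRateCoeffDefect (pull)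
open Literature.MathematicalPhysics.QuantumFieldTheory.Balaban1983to89.B11SectG (BlockNorm HasMaj)
open Literature.MathematicalPhysics.QuantumFieldTheory.Balaban1983to89.B5Prop11Plancherel (Tor fine)
open Literature.MathematicalPhysics.QuantumFieldTheory.Balaban1983to89.B6Lemma24Torus (pbox)
open Literature.MathematicalPhysics.QuantumFieldTheory.Balaban1983to89.B6BondEliminationTorus (pdist)
open Literature.MathematicalPhysics.QuantumFieldTheory.Balaban1983to89.B6Cov2156Torus (deltaPol one_le_M)
open Literature.MathematicalPhysics.QuantumFieldTheory.Balaban1983to89.B6LowerBound2153Torus (rep rep_mem_pbox)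
open Literature.MathematicalPhysics.QuantumFieldTheory.Balaban1983to89.B6UnitTorusCarrier (unitTorusGeo unitTorusGeo_dist_nonneg pdist_rep_rep)
open Literature.MathematicalPhysics.QuantumFieldTheory.King1986.Torus (blockOf tdistT tdistT_nonneg)
open Literature.Barriers.QuantumFields (traceForm)
open Summit.QuantumFields.YangMills.BalabanUVNodes.N15.OperatorReadout (opGeo)
open Summit.QuantumFields.YangMills.BalabanUVNodes.N15.GenuineSite (etaRateIneqSite_opGeo_unit)
open Summit.QuantumFields.YangMills.BalabanUVNodes.N15.SiteLayer (hasMaj_exp_mono)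
open Summit.QuantumFields.YangMills.BalabanUVNodes.N15.VectorPiece (bshiftEquiv kingPrV tensorId unitTorusGeoS rateWeight_unitTorusGeoS blkFine_comp_kingPrV)
open Summit.QuantumFields.YangMills.BalabanUVNodes.N15.MatrixSpecies (basisConst basisConst_nonneg liftBlk liftMap)
open Summit.QuantumFields.YangMills.BalabanUVNodes.N15.UnitLayerBgCol (cdist cdist_eq cdist_nonneg siteC siteC_apply siteC_zero siteC_sub_letters unitBondMatC)
open Summit.QuantumFields.YangMills.BalabanUVNodes.N15.BackgroundLayer (gavgM)
open Summit.QuantumFields.YangMills.BalabanUVNodes.N15.TwoGrid (gOp qvRe qvAdjRe)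
open Summit.QuantumFields.YangMills.BalabanUVNodes.N15.Gluing (SfIdx sfGeo sfInstance sfInstance_reg335_iff sfInstance_gf_M CvX CvX' cvM cvBlk CvNorm cvNL cvNL' cvGlued cvGlued')
open Summit.QuantumFields.YangMills.BalabanUVNodes.N15.GluedZeroField (zCovC zCovF zAnyC zAnyF zCovC_eq_zAnyC zCovF_eq_zAnyF exists_zAny_letters)

variable (d : ℕ) {L : ℕ} [NeZero L] (mm ι : Type) [Fintype mm] [Fintype ι] [DecidableEq ι] (a : ℝ)

/-! ## §1 The U-live site kernel reading an arbitrary inner propagator family -/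

section Kernel

/-- ★ **THE U-LIVE SITE-LAYER η-DIFFERENCE KERNEL FOR ANY INNER PROPAGATOR FAMILY** `(Xc i A′, Xf i A′)` and averaging perturbation family `(Dc, Ec, Df, Ef)`:
`(A′, y, y′) ↦ siteC^{(L^rL^k)}(zAnyF (Xf i A′) (Df i A′) (Ef i A′))(pp,qq) − siteC^{(L^k)}(zAnyC (Xc i A′) (Dc i A′) (Ec i A′))(pp,qq)` at the coloured unit bonds — the (3.48)-shaped site objects
`(Sym unitBondMatC((Q⊗1 + D) X (Q*⊗1 + E)))⁻¹` ((Q-3) `siteC_eq_inv_symPart_sandwich`) of ONE propagator `X` read at two spacings. [cite: Balaban1985BackgroundPropagators, Thm 3.2 (3.48) p.398, (3.132) p.422, (3.78)–(3.81) p.406 (shapes)] -/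
def foSiteAny (hL : Odd L ∧ 1 < L) (α β : Fin (d + 1)) (j j' : ι)
    (Xc : ∀ i : SfIdx d L, (Fin (d + 1) → CvX' d L i.m i.kk i.r hL → Matrix mm mm ℂ) → ((CvX d L i.m i.kk hL × ι → ℝ) →ₗ[ℝ] (CvX d L i.m i.kk hL × ι → ℝ)))
    (Xf : ∀ i : SfIdx d L, (Fin (d + 1) → CvX' d L i.m i.kk i.r hL → Matrix mm mm ℂ) → ((CvX' d L i.m i.kk i.r hL × ι → ℝ) →ₗ[ℝ] (CvX' d L i.m i.kk i.r hL × ι → ℝ)))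
    (Dc : ∀ i : SfIdx d L, (Fin (d + 1) → CvX' d L i.m i.kk i.r hL → Matrix mm mm ℂ) → ((CvX d L i.m i.kk hL × ι → ℝ) →ₗ[ℝ] ((Tor (cvM d L i.m i.kk hL) × Fin (d + 1)) × ι → ℝ)))
    (Ec : ∀ i : SfIdx d L, (Fin (d + 1) → CvX' d L i.m i.kk i.r hL → Matrix mm mm ℂ) → (((Tor (cvM d L i.m i.kk hL) × Fin (d + 1)) × ι → ℝ) →ₗ[ℝ] (CvX d L i.m i.kk hL × ι → ℝ)))
    (Df : ∀ i : SfIdx d L, (Fin (d + 1) → CvX' d L i.m i.kk i.r hL → Matrix mm mm ℂ) → ((CvX' d L i.m i.kk i.r hL × ι → ℝ) →ₗ[ℝ] ((Tor (cvM d L i.m i.kk hL) × Fin (d + 1)) × ι → ℝ)))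
    (Ef : ∀ i : SfIdx d L, (Fin (d + 1) → CvX' d L i.m i.kk i.r hL → Matrix mm mm ℂ) → (((Tor (cvM d L i.m i.kk hL) × Fin (d + 1)) × ι → ℝ) →ₗ[ℝ] (CvX' d L i.m i.kk i.r hL × ι → ℝ)))
    (i : SfIdx d L) : B9.SiteKernel (sfInstance d mm ι hL i).gc (sfInstance d mm ι hL i).Bf :=
  ⟨fun A' y y' =>
    siteC (cvM d L i.m i.kk hL) ι (L ^ i.r * L ^ i.kk) a (zAnyF d ι a hL i.m i.kk i.r (Xf i A') (Df i A') (Ef i A'))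
        ((⟨rep (cvM d L i.m i.kk hL) y, rep_mem_pbox (cvM d L i.m i.kk hL) y⟩, α), j) ((⟨rep (cvM d L i.m i.kk hL) y', rep_mem_pbox (cvM d L i.m i.kk hL) y'⟩, β), j')
      - siteC (cvM d L i.m i.kk hL) ι (L ^ i.kk) a (zAnyC d ι a hL i.m i.kk (Xc i A') (Dc i A') (Ec i A'))
        ((⟨rep (cvM d L i.m i.kk hL) y, rep_mem_pbox (cvM d L i.m i.kk hL) y⟩, α), j) ((⟨rep (cvM d L i.m i.kk hL) y', rep_mem_pbox (cvM d L i.m i.kk hL) y'⟩, β), j')⟩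

/-- Unfolding of `foSiteAny`. [folklore] -/
theorem foSiteAny_ker (hL : Odd L ∧ 1 < L) (α β : Fin (d + 1)) (j j' : ι)
    (Xc : ∀ i : SfIdx d L, (Fin (d + 1) → CvX' d L i.m i.kk i.r hL → Matrix mm mm ℂ) → ((CvX d L i.m i.kk hL × ι → ℝ) →ₗ[ℝ] (CvX d L i.m i.kk hL × ι → ℝ)))
    (Xf : ∀ i : SfIdx d L, (Fin (d + 1) → CvX' d L i.m i.kk i.r hL → Matrix mm mm ℂ) → ((CvX' d L i.m i.kk i.r hL × ι → ℝ) →ₗ[ℝ] (CvX' d L i.m i.kk i.r hL × ι → ℝ)))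
    (Dc : ∀ i : SfIdx d L, (Fin (d + 1) → CvX' d L i.m i.kk i.r hL → Matrix mm mm ℂ) → ((CvX d L i.m i.kk hL × ι → ℝ) →ₗ[ℝ] ((Tor (cvM d L i.m i.kk hL) × Fin (d + 1)) × ι → ℝ)))
    (Ec : ∀ i : SfIdx d L, (Fin (d + 1) → CvX' d L i.m i.kk i.r hL → Matrix mm mm ℂ) → (((Tor (cvM d L i.m i.kk hL) × Fin (d + 1)) × ι → ℝ) →ₗ[ℝ] (CvX d L i.m i.kk hL × ι → ℝ)))
    (Df : ∀ i : SfIdx d L, (Fin (d + 1) → CvX' d L i.m i.kk i.r hL → Matrix mm mm ℂ) → ((CvX' d L i.m i.kk i.r hL × ι → ℝ) →ₗ[ℝ] ((Tor (cvM d L i.m i.kk hL) × Fin (d + 1)) × ι → ℝ)))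
    (Ef : ∀ i : SfIdx d L, (Fin (d + 1) → CvX' d L i.m i.kk i.r hL → Matrix mm mm ℂ) → (((Tor (cvM d L i.m i.kk hL) × Fin (d + 1)) × ι → ℝ) →ₗ[ℝ] (CvX' d L i.m i.kk i.r hL × ι → ℝ)))
    (i : SfIdx d L) (A' : Fin (d + 1) → CvX' d L i.m i.kk i.r hL → Matrix mm mm ℂ) (y y' : Tor (cvM d L i.m i.kk hL)) :
    (foSiteAny d mm ι a hL α β j j' Xc Xf Dc Ec Df Ef i).ker A' y y' =
      siteC (cvM d L i.m i.kk hL) ι (L ^ i.r * L ^ i.kk) a (zAnyF d ι a hL i.m i.kk i.r (Xf i A') (Df i A') (Ef i A'))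
          ((⟨rep (cvM d L i.m i.kk hL) y, rep_mem_pbox (cvM d L i.m i.kk hL) y⟩, α), j) ((⟨rep (cvM d L i.m i.kk hL) y', rep_mem_pbox (cvM d L i.m i.kk hL) y'⟩, β), j')
        - siteC (cvM d L i.m i.kk hL) ι (L ^ i.kk) a (zAnyC d ι a hL i.m i.kk (Xc i A') (Dc i A') (Ec i A'))
          ((⟨rep (cvM d L i.m i.kk hL) y, rep_mem_pbox (cvM d L i.m i.kk hL) y⟩, α), j) ((⟨rep (cvM d L i.m i.kk hL) y', rep_mem_pbox (cvM d L i.m i.kk hL) y'⟩, β), j') := rfl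

/-- ★ **CONSISTENCY — AT dag-n15-c's FILE 133 PROPAGATOR FAMILY THE KERNEL IS (Q-3)'s `foSiteCov`** (pointwise, every index, potential and sites; (𝟙P-a) `zCovC_eq_zAnyC` ∕ `zCovF_eq_zAnyF`). [bookkeeping] -/
theorem foSiteAny_cvGlued [DecidableEq mm] (e : Matrix mm mm ℂ ≃L[ℝ] (ι → ℝ)) (hL : Odd L ∧ 1 < L) (α β : Fin (d + 1)) (j j' : ι)
    (Dc : ∀ i : SfIdx d L, (Fin (d + 1) → CvX' d L i.m i.kk i.r hL → Matrix mm mm ℂ) → ((CvX d L i.m i.kk hL × ι → ℝ) →ₗ[ℝ] ((Tor (cvM d L i.m i.kk hL) × Fin (d + 1)) × ι → ℝ)))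
    (Ec : ∀ i : SfIdx d L, (Fin (d + 1) → CvX' d L i.m i.kk i.r hL → Matrix mm mm ℂ) → (((Tor (cvM d L i.m i.kk hL) × Fin (d + 1)) × ι → ℝ) →ₗ[ℝ] (CvX d L i.m i.kk hL × ι → ℝ)))
    (Df : ∀ i : SfIdx d L, (Fin (d + 1) → CvX' d L i.m i.kk i.r hL → Matrix mm mm ℂ) → ((CvX' d L i.m i.kk i.r hL × ι → ℝ) →ₗ[ℝ] ((Tor (cvM d L i.m i.kk hL) × Fin (d + 1)) × ι → ℝ)))
    (Ef : ∀ i : SfIdx d L, (Fin (d + 1) → CvX' d L i.m i.kk i.r hL → Matrix mm mm ℂ) → (((Tor (cvM d L i.m i.kk hL) × Fin (d + 1)) × ι → ℝ) →ₗ[ℝ] (CvX' d L i.m i.kk i.r hL × ι → ℝ)))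
    (i : SfIdx d L) (A' : Fin (d + 1) → CvX' d L i.m i.kk i.r hL → Matrix mm mm ℂ) (y y' : Tor (cvM d L i.m i.kk hL)) :
    (foSiteAny d mm ι a hL α β j j'
        (fun i A' => cvGlued d L i.m i.kk hL a ((((L ^ i.kk : ℕ) : ℝ))⁻¹) ι e (fun _ _ => (1 : Matrix mm mm ℂ))
          (fun μ x => NormedSpace.exp (((((L ^ i.kk : ℕ) : ℝ))⁻¹) • gavgM (Matrix mm mm ℂ) (Fin (d + 1)) (kingPrV L i.kk i.r (cvM d L i.m i.kk hL)) A' μ x)) (cvNL d L i.m i.kk hL a ι) (fun _ => 0))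
        (fun i A' => cvGlued' d L i.m i.kk i.r hL a ((((L ^ i.r * L ^ i.kk : ℕ) : ℝ))⁻¹) ι e (fun _ _ => (1 : Matrix mm mm ℂ))
          (fun μ x' => NormedSpace.exp (((((L ^ i.r * L ^ i.kk : ℕ) : ℝ))⁻¹) • A' μ x')) (cvNL' d L i.m i.kk i.r hL a ι) (fun _ => 0))
        Dc Ec Df Ef i).ker A' y y' =
      (foSiteCov d mm ι a e hL α β j j' Dc Ec Df Ef i).ker A' y y' := by
  rw [foSiteAny_ker, foSiteCov_ker, zCovC_eq_zAnyC, zCovF_eq_zAnyF]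

end Kernel

/-! ## §2 ★★★ `NE2PlusSite` by name for the site kernel reading an arbitrary inner propagator family -/

section SiteLayer

set_option maxHeartbeats 800000 in
/-- ★★★ **`NE2PlusSite` — THE NODE's SECOND CONJUNCT BY NAME — FOR THE U-LIVE SITE KERNEL READING AN ARBITRARY INNER PROPAGATOR FAMILY THROUGH A PERTURBED AVERAGING, ON dag-n15-c's LIVE
FAMILY.**  For odd `L ≥ 7`, `a, c₃₅ > 0`, `ι` nonempty, directions `α β`, colours `j j′`, exponents `(d′, p)`, a propagator family `(Xc, Xf)` with the DISPLAYED increment rows — some rate `ρ_X > 0`,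
constant `K_X ≥ 0`, cube floor `w_X`, window `s_X > 0` such that under `Reg335 c₃₅ α₀ A′`, `L^m ≥ w_X`, `c₃₅L^mα₀ ≤ s_X`: `|Xc i A′ − G⊗1|, |Xf i A′ − G′⊗1| ≤ K_X·(c₃₅L^mα₀)·e^{−ρ_X d}` and
`|𝔇(Xf i A′ − G′⊗1, Xc i A′ − G⊗1)| ≤ K_X·(L^k)^{−1∕16}·e^{−ρ_X d}` — and a perturbation family `(Dc, Ec, Df, Ef)` with (Q-3)'s displayed rows (every rate `ρ > 0`: sizes `K_D·(c₃₅L^mα₀)`, comparisons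
`K_D·(L^k)^{−1∕16}`): `NE2PlusSite d′ p c₃₅ (sfInstance d mm ι hL) (foSiteAny d mm ι a hL α β j j′ Xc Xf Dc Ec Df Ef)`.  Constants `(M₅, δ, a₀, C, γ) = (max(w_X,1), δ_S, a₀(K_X, K_D),
C_S(K(K_X + 3 + 2K_D) + 1) + 1, 1∕16)`; mechanism = (Q-3)'s with (𝟙P-b) `exists_zAny_letters`.  MODEL objects; NOT [B9] Thm 3.2 as printed.
[cite: Balaban1985BackgroundPropagators, Thm 3.2 (3.48) p.398 («with the same constants») + (3.132) p.422 + Thm 3.14 pp.426–427 (quantifier template, shapes), (3.62)–(3.65) pp.402–403, (3.78)–(3.81) p.406, (3.35) p.396; Balaban1984PropagatorsI, (1.66) p.29,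
(1.102)–(1.103) p.34; King1986, Lemma 4.5 (4.38)–(4.41) pp.674–675 (mechanism); CombesThomas1973, §II (mechanism)] -/
theorem ne2PlusSite_foSiteAny [Nonempty ι] (hL : Odd L ∧ 1 < L) (hL7 : 7 ≤ L) (ha : 0 < a) {c35 : ℝ} (hc35 : 0 < c35) (α β : Fin (d + 1)) (j j' : ι) (d' : ℕ) (p : ℝ)
    (Xc : ∀ i : SfIdx d L, (Fin (d + 1) → CvX' d L i.m i.kk i.r hL → Matrix mm mm ℂ) → ((CvX d L i.m i.kk hL × ι → ℝ) →ₗ[ℝ] (CvX d L i.m i.kk hL × ι → ℝ)))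
    (Xf : ∀ i : SfIdx d L, (Fin (d + 1) → CvX' d L i.m i.kk i.r hL → Matrix mm mm ℂ) → ((CvX' d L i.m i.kk i.r hL × ι → ℝ) →ₗ[ℝ] (CvX' d L i.m i.kk i.r hL × ι → ℝ)))
    (Dc : ∀ i : SfIdx d L, (Fin (d + 1) → CvX' d L i.m i.kk i.r hL → Matrix mm mm ℂ) → ((CvX d L i.m i.kk hL × ι → ℝ) →ₗ[ℝ] ((Tor (cvM d L i.m i.kk hL) × Fin (d + 1)) × ι → ℝ)))
    (Ec : ∀ i : SfIdx d L, (Fin (d + 1) → CvX' d L i.m i.kk i.r hL → Matrix mm mm ℂ) → (((Tor (cvM d L i.m i.kk hL) × Fin (d + 1)) × ι → ℝ) →ₗ[ℝ] (CvX d L i.m i.kk hL × ι → ℝ)))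
    (Df : ∀ i : SfIdx d L, (Fin (d + 1) → CvX' d L i.m i.kk i.r hL → Matrix mm mm ℂ) → ((CvX' d L i.m i.kk i.r hL × ι → ℝ) →ₗ[ℝ] ((Tor (cvM d L i.m i.kk hL) × Fin (d + 1)) × ι → ℝ)))
    (Ef : ∀ i : SfIdx d L, (Fin (d + 1) → CvX' d L i.m i.kk i.r hL → Matrix mm mm ℂ) → (((Tor (cvM d L i.m i.kk hL) × Fin (d + 1)) × ι → ℝ) →ₗ[ℝ] (CvX' d L i.m i.kk i.r hL × ι → ℝ)))
    (hX : ∃ ρX KX wX sX : ℝ, 0 < ρX ∧ 0 ≤ KX ∧ 0 < sX ∧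
      ∀ (i : SfIdx d L) (α₀ : ℝ) (A' : Fin (d + 1) → CvX' d L i.m i.kk i.r hL → Matrix mm mm ℂ), 0 < α₀ → wX ≤ ((L ^ i.m : ℕ) : ℝ) → c35 * (L : ℝ) ^ i.m * α₀ ≤ sX →
        (sfInstance d mm ι hL i).Bf.Reg335 c35 α₀ A' →
        HasMaj (CvNorm d L i.m i.kk hL ι) (CvNorm d L i.m i.kk hL ι) (Xc i A' - tensorId ι (gOp (cvM d L i.m i.kk hL) (L ^ i.kk) a))
          (fun y y' => KX * (c35 * (L : ℝ) ^ i.m * α₀) * Real.exp (-(ρX * (unitTorusGeo L i.kk (cvM d L i.m i.kk hL)).dist y y'))) ∧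
        HasMaj (BlockNorm.ofBlocks (unitTorusGeo L i.kk (cvM d L i.m i.kk hL)) (liftBlk (fun b : CvX' d L i.m i.kk i.r hL => blockOf (L ^ i.r * L ^ i.kk) (cvM d L i.m i.kk hL) b.1) ι))
          (BlockNorm.ofBlocks (unitTorusGeo L i.kk (cvM d L i.m i.kk hL)) (liftBlk (fun b : CvX' d L i.m i.kk i.r hL => blockOf (L ^ i.r * L ^ i.kk) (cvM d L i.m i.kk hL) b.1) ι))
          (Xf i A' - tensorId ι (gOp (cvM d L i.m i.kk hL) (L ^ i.r * L ^ i.kk) a))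
          (fun y y' => KX * (c35 * (L : ℝ) ^ i.m * α₀) * Real.exp (-(ρX * (unitTorusGeo L i.kk (cvM d L i.m i.kk hL)).dist y y'))) ∧
        HasMaj (CvNorm d L i.m i.kk hL ι)
          (BlockNorm.ofBlocks (unitTorusGeo L i.kk (cvM d L i.m i.kk hL)) (liftBlk (fun b : CvX' d L i.m i.kk i.r hL => blockOf (L ^ i.r * L ^ i.kk) (cvM d L i.m i.kk hL) b.1) ι))
          (idef (pull (liftMap (kingPrV L i.kk i.r (cvM d L i.m i.kk hL)) ι)) (pull (liftMap (kingPrV L i.kk i.r (cvM d L i.m i.kk hL)) ι))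
            (Xf i A' - tensorId ι (gOp (cvM d L i.m i.kk hL) (L ^ i.r * L ^ i.kk) a)) (Xc i A' - tensorId ι (gOp (cvM d L i.m i.kk hL) (L ^ i.kk) a)))
          (fun y y' => KX * ((((L ^ i.kk : ℕ) : ℝ)) ^ (-(1 / 16 : ℝ))) * Real.exp (-(ρX * (unitTorusGeo L i.kk (cvM d L i.m i.kk hL)).dist y y'))))
    (hfam : ∀ ρ : ℝ, 0 < ρ → ∃ KD s₀ : ℝ, 0 ≤ KD ∧ 0 < s₀ ∧
      ∀ (i : SfIdx d L) (α₀ : ℝ) (A' : Fin (d + 1) → CvX' d L i.m i.kk i.r hL → Matrix mm mm ℂ), 0 < α₀ → c35 * (L : ℝ) ^ i.m * α₀ ≤ s₀ → (sfInstance d mm ι hL i).Bf.Reg335 c35 α₀ A' →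
        HasMaj (CvNorm d L i.m i.kk hL ι) (BlockNorm.ofBlocks (unitTorusGeo L i.kk (cvM d L i.m i.kk hL)) (liftBlk (fun b : Tor (cvM d L i.m i.kk hL) × Fin (d + 1) => b.1) ι)) (Dc i A')
          (fun y y' => KD * (c35 * (L : ℝ) ^ i.m * α₀) * Real.exp (-(ρ * (unitTorusGeo L i.kk (cvM d L i.m i.kk hL)).dist y y'))) ∧
        HasMaj (BlockNorm.ofBlocks (unitTorusGeo L i.kk (cvM d L i.m i.kk hL)) (liftBlk (fun b : CvX' d L i.m i.kk i.r hL => blockOf (L ^ i.r * L ^ i.kk) (cvM d L i.m i.kk hL) b.1) ι))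
          (BlockNorm.ofBlocks (unitTorusGeo L i.kk (cvM d L i.m i.kk hL)) (liftBlk (fun b : Tor (cvM d L i.m i.kk hL) × Fin (d + 1) => b.1) ι)) (Df i A')
          (fun y y' => KD * (c35 * (L : ℝ) ^ i.m * α₀) * Real.exp (-(ρ * (unitTorusGeo L i.kk (cvM d L i.m i.kk hL)).dist y y'))) ∧
        HasMaj (BlockNorm.ofBlocks (unitTorusGeo L i.kk (cvM d L i.m i.kk hL)) (liftBlk (fun b : Tor (cvM d L i.m i.kk hL) × Fin (d + 1) => b.1) ι)) (CvNorm d L i.m i.kk hL ι) (Ec i A')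
          (fun y y' => KD * (c35 * (L : ℝ) ^ i.m * α₀) * Real.exp (-(ρ * (unitTorusGeo L i.kk (cvM d L i.m i.kk hL)).dist y y'))) ∧
        HasMaj (BlockNorm.ofBlocks (unitTorusGeo L i.kk (cvM d L i.m i.kk hL)) (liftBlk (fun b : Tor (cvM d L i.m i.kk hL) × Fin (d + 1) => b.1) ι))
          (BlockNorm.ofBlocks (unitTorusGeo L i.kk (cvM d L i.m i.kk hL)) (liftBlk (fun b : CvX' d L i.m i.kk i.r hL => blockOf (L ^ i.r * L ^ i.kk) (cvM d L i.m i.kk hL) b.1) ι)) (Ef i A')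
          (fun y y' => KD * (c35 * (L : ℝ) ^ i.m * α₀) * Real.exp (-(ρ * (unitTorusGeo L i.kk (cvM d L i.m i.kk hL)).dist y y'))) ∧
        HasMaj (CvNorm d L i.m i.kk hL ι) (BlockNorm.ofBlocks (unitTorusGeo L i.kk (cvM d L i.m i.kk hL)) (liftBlk (fun b : Tor (cvM d L i.m i.kk hL) × Fin (d + 1) => b.1) ι))
          (Df i A' ∘ₗ pull (liftMap (kingPrV L i.kk i.r (cvM d L i.m i.kk hL)) ι) - Dc i A')
          (fun y y' => KD * ((((L ^ i.kk : ℕ) : ℝ)) ^ (-(1 / 16 : ℝ))) * Real.exp (-(ρ * (unitTorusGeo L i.kk (cvM d L i.m i.kk hL)).dist y y'))) ∧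
        HasMaj (BlockNorm.ofBlocks (unitTorusGeo L i.kk (cvM d L i.m i.kk hL)) (liftBlk (fun b : Tor (cvM d L i.m i.kk hL) × Fin (d + 1) => b.1) ι))
          (BlockNorm.ofBlocks (unitTorusGeo L i.kk (cvM d L i.m i.kk hL)) (liftBlk (fun b : CvX' d L i.m i.kk i.r hL => blockOf (L ^ i.r * L ^ i.kk) (cvM d L i.m i.kk hL) b.1) ι))
          (Ef i A' - pull (liftMap (kingPrV L i.kk i.r (cvM d L i.m i.kk hL)) ι) ∘ₗ Ec i A')
          (fun y y' => KD * ((((L ^ i.kk : ℕ) : ℝ)) ^ (-(1 / 16 : ℝ))) * Real.exp (-(ρ * (unitTorusGeo L i.kk (cvM d L i.m i.kk hL)).dist y y')))) :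
    NE2PlusSite d' p c35 (sfInstance d mm ι hL) (foSiteAny d mm ι a hL α β j j' Xc Xf Dc Ec Df Ef) := by
  have hLpos : 0 < L := Nat.pos_of_ne_zero (NeZero.ne L)
  have hLr : (0 : ℝ) < (L : ℝ) := Nat.cast_pos.mpr hLpos
  have hL1 : (1 : ℝ) ≤ (L : ℝ) := by exact_mod_cast hLpos
  -- the four constant packages: the propagator family's rows, (𝟙P-b)'s letters at that rate (rate `ρ` for the averaging rows), the averaging family's constant at `ρ`, (J-c′)'s site letter
  obtain ⟨ρX, KX, wX, sX, hρX, hKX, hsX, HXr⟩ := hX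
  obtain ⟨ρ, δz, Kz, hρ, -, hδz, hKz, HZ⟩ := exists_zAny_letters d ι a hL ha hρX
  obtain ⟨KD, s₀, hKD, hs₀, HD⟩ := hfam ρ hρ
  obtain ⟨C, δS, ζ₀, hC, hδS, hζ₀, HS⟩ := siteC_sub_letters d (Fintype.card ι) ha hδz
  -- the thresholds: `a_ζ` (`K_Z(K_X + 2K_D) r_A ≤ ζ₀`), `a_X` (`K_X r_A ≤ 1`), `a_D` (`K_D r_A ≤ 1`), `a_SX` (`r_A ≤ s_X`), `a_S` (`r_A ≤ s₀`)
  let aζ : ℝ := ζ₀ / (Kz * (KX + 2 * KD + 1) * c35)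
  have haζ : 0 < aζ := by positivity
  let aX : ℝ := 1 / ((KX + 1) * c35)
  have haX : 0 < aX := by positivity
  let aD : ℝ := 1 / ((KD + 1) * c35)
  have haD : 0 < aD := by positivity
  let aSX : ℝ := sX / c35
  have haSX : 0 < aSX := by positivity
  let aS : ℝ := s₀ / c35
  have haS0 : 0 < aS := by positivity
  let a₀ : ℝ := min (min (min aζ aX) (min aD aSX)) aS
  have ha₀ : 0 < a₀ := lt_min (lt_min (lt_min haζ haX) (lt_min haD haSX)) haS0
  have ha₀ζ : a₀ ≤ aζ := ((min_le_left _ _).trans (min_le_left _ _)).trans (min_le_left _ _)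
  have ha₀X : a₀ ≤ aX := ((min_le_left _ _).trans (min_le_left _ _)).trans (min_le_right _ _)
  have ha₀D : a₀ ≤ aD := ((min_le_left _ _).trans (min_le_right _ _)).trans (min_le_left _ _)
  have ha₀SX : a₀ ≤ aSX := ((min_le_left _ _).trans (min_le_right _ _)).trans (min_le_right _ _)
  have ha₀S : a₀ ≤ aS := min_le_right _ _
  let M₁ : ℝ := max wX 1
  have hM₁ : 0 < M₁ := lt_of_lt_of_le one_pos (le_max_right _ _)
  refine ⟨M₁, δS, a₀, C * (Kz * (KX + 3 + 2 * KD) + 1) + 1, 1 / 16, hM₁, hδS, ha₀, by positivity, by norm_num, fun i hM α₀ hα₀ hMa A' hA' => ?_⟩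
  -- the index's scalar facts
  rw [sfInstance_gf_M] at hM hMa
  have hwX : wX ≤ ((L ^ i.m : ℕ) : ℝ) := by push_cast; exact (le_max_left _ _).trans hM
  have hx1 : (1 : ℝ) ≤ (L : ℝ) ^ i.kk := one_le_pow₀ hL1
  have hxpos : (0 : ℝ) < (L : ℝ) ^ i.kk := pow_pos hLr _
  have hcast : (((L ^ i.kk : ℕ) : ℝ)) = (L : ℝ) ^ i.kk := by push_cast; rfl
  have hLk : 1 ≤ L ^ i.kk := Nat.one_le_pow _ _ hLpos
  have hLrr : 1 ≤ L ^ i.r := Nat.one_le_pow _ _ hLpos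
  set t : ℝ := ((L : ℝ) ^ i.kk) ^ (-(1 / 16 : ℝ)) with ht_def
  have ht0 : 0 ≤ t := Real.rpow_nonneg hxpos.le _
  have hθt : (((L ^ i.kk : ℕ) : ℝ)) ^ (-(1 / 16 : ℝ)) = t := by rw [hcast]
  have hinv : ((((L ^ i.kk : ℕ) : ℝ)))⁻¹ ≤ t := by
    rw [hcast, ← Real.rpow_neg_one]; exact Real.rpow_le_rpow_of_exponent_le hx1 (by norm_num)
  have hη0 : 0 ≤ ((((L ^ i.kk : ℕ) : ℝ)))⁻¹ := by positivity
  have hθ0 : 0 ≤ (((L ^ i.kk : ℕ) : ℝ)) ^ (-(1 / 16 : ℝ)) := by rw [hθt]; exact ht0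
  have ht1 : t ≤ 1 := by
    rw [ht_def]; exact Real.rpow_le_one_of_one_le_of_nonpos hx1 (by norm_num)
  -- the field scale `r_A = c₃₅L^mα₀` and the rows of both families there
  have hrA0 : 0 ≤ c35 * (L : ℝ) ^ i.m * α₀ := by positivity
  have hrAa : c35 * (L : ℝ) ^ i.m * α₀ ≤ c35 * a₀ := by
    rw [mul_assoc]; exact mul_le_mul_of_nonneg_left hMa hc35.le
  have hrS : c35 * (L : ℝ) ^ i.m * α₀ ≤ s₀ := by
    calc c35 * (L : ℝ) ^ i.m * α₀ ≤ c35 * aS := hrAa.trans (mul_le_mul_of_nonneg_left ha₀S hc35.le)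
      _ = s₀ := by
          show c35 * (s₀ / c35) = s₀
          field_simp
  have hrSX : c35 * (L : ℝ) ^ i.m * α₀ ≤ sX := by
    calc c35 * (L : ℝ) ^ i.m * α₀ ≤ c35 * aSX := hrAa.trans (mul_le_mul_of_nonneg_left ha₀SX hc35.le)
      _ = sX := by
          show c35 * (sX / c35) = sX
          field_simp
  obtain ⟨hDc, hDf, hEc, hEf, hDd, hEd⟩ := HD i α₀ A' hα₀ hrS hA'
  obtain ⟨hYc, hYf, hYd⟩ := HXr i α₀ A' hα₀ hwX hrSX hA'
  -- the margins: `K_X r_A ≤ 1`, `K_D r_A ≤ 1`, `K_Z(K_X + 2K_D) r_A ≤ ζ₀`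
  have hXr1 : KX * (c35 * (L : ℝ) ^ i.m * α₀) ≤ 1 := by
    calc KX * (c35 * (L : ℝ) ^ i.m * α₀) ≤ (KX + 1) * (c35 * aX) :=
          mul_le_mul (by linarith) (hrAa.trans (mul_le_mul_of_nonneg_left ha₀X hc35.le)) hrA0 (by positivity)
      _ = 1 := by
          show (KX + 1) * (c35 * (1 / ((KX + 1) * c35))) = 1
          field_simp
  have hDr1 : KD * (c35 * (L : ℝ) ^ i.m * α₀) ≤ 1 := by
    calc KD * (c35 * (L : ℝ) ^ i.m * α₀) ≤ (KD + 1) * (c35 * aD) :=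
          mul_le_mul (by linarith) (hrAa.trans (mul_le_mul_of_nonneg_left ha₀D hc35.le)) hrA0 (by positivity)
      _ = 1 := by
          show (KD + 1) * (c35 * (1 / ((KD + 1) * c35))) = 1
          field_simp
  have hζle : Kz * (KX * (c35 * (L : ℝ) ^ i.m * α₀) + KD * (c35 * (L : ℝ) ^ i.m * α₀) + KD * (c35 * (L : ℝ) ^ i.m * α₀)) ≤ ζ₀ := by
    have hre : Kz * (KX * (c35 * (L : ℝ) ^ i.m * α₀) + KD * (c35 * (L : ℝ) ^ i.m * α₀) + KD * (c35 * (L : ℝ) ^ i.m * α₀)) =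
        Kz * (KX + 2 * KD) * (c35 * (L : ℝ) ^ i.m * α₀) := by ring
    rw [hre]
    calc Kz * (KX + 2 * KD) * (c35 * (L : ℝ) ^ i.m * α₀) ≤ Kz * (KX + 2 * KD + 1) * (c35 * aζ) :=
          mul_le_mul (mul_le_mul_of_nonneg_left (by linarith) hKz.le) (hrAa.trans (mul_le_mul_of_nonneg_left ha₀ζ hc35.le)) hrA0 (by positivity)
      _ = ζ₀ := by
          show Kz * (KX + 2 * KD + 1) * (c35 * (ζ₀ / (Kz * (KX + 2 * KD + 1) * c35))) = ζ₀
          field_simp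
  have hρX0 : 0 ≤ KX * (c35 * (L : ℝ) ^ i.m * α₀) := by positivity
  have hθX0 : 0 ≤ KX * ((((L ^ i.kk : ℕ) : ℝ)) ^ (-(1 / 16 : ℝ))) := mul_nonneg hKX hθ0
  have hρD0 : 0 ≤ KD * (c35 * (L : ℝ) ^ i.m * α₀) := by positivity
  have hτD0 : 0 ≤ KD * ((((L ^ i.kk : ℕ) : ℝ)) ^ (-(1 / 16 : ℝ))) := mul_nonneg hKD hθ0
  have hζ0 : 0 ≤ Kz * (KX * (c35 * (L : ℝ) ^ i.m * α₀) + KD * (c35 * (L : ℝ) ^ i.m * α₀) + KD * (c35 * (L : ℝ) ^ i.m * α₀)) := by positivity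
  have hτ0 : 0 ≤ Kz * (KX * ((((L ^ i.kk : ℕ) : ℝ)) ^ (-(1 / 16 : ℝ))) +
      (KX * (c35 * (L : ℝ) ^ i.m * α₀) + KD * (c35 * (L : ℝ) ^ i.m * α₀) + KD * (c35 * (L : ℝ) ^ i.m * α₀)) * ((((L ^ i.kk : ℕ) : ℝ)) ^ (-(1 / 16 : ℝ))) +
      KD * ((((L ^ i.kk : ℕ) : ℝ)) ^ (-(1 / 16 : ℝ))) + KD * ((((L ^ i.kk : ℕ) : ℝ)) ^ (-(1 / 16 : ℝ)))) := by positivity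
  -- (𝟙P-b): the three letters of the middle factors at this index, potential, propagator and averaging family
  obtain ⟨hZ, hZ', hZZ⟩ := HZ i.m i.kk i.r i.one_le (Xc i A') (Xf i A') (KX * (c35 * (L : ℝ) ^ i.m * α₀)) (KX * ((((L ^ i.kk : ℕ) : ℝ)) ^ (-(1 / 16 : ℝ))))
    hρX0 hXr1 hθX0 hYc hYf hYd (Dc i A') (Ec i A') (Df i A') (Ef i A')
    (KD * (c35 * (L : ℝ) ^ i.m * α₀)) (KD * (c35 * (L : ℝ) ^ i.m * α₀)) (KD * ((((L ^ i.kk : ℕ) : ℝ)) ^ (-(1 / 16 : ℝ)))) (KD * ((((L ^ i.kk : ℕ) : ℝ)) ^ (-(1 / 16 : ℝ))))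
    hρD0 hDr1 hρD0 hDr1 hτD0 hτD0 hDc hDf hEc hEf hDd hEd
  -- (J-c′): the η-difference letter of the site objects
  have HSi := HS (cvM d L i.m i.kk hL) ι le_rfl (L ^ i.kk) (L ^ i.r * L ^ i.kk) (L ^ i.r) hLk hLrr rfl
    (zAnyC d ι a hL i.m i.kk (Xc i A') (Dc i A') (Ec i A')) (zAnyF d ι a hL i.m i.kk i.r (Xf i A') (Df i A') (Ef i A')) _ _ hζ0 hζle hτ0 hZ hZ' hZZ
  -- the readout at unit sites
  have hη : (sfGeo d hL i).eta ≠ 0 := by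
    show ((L : ℝ) ^ i.kk)⁻¹ ≠ 0
    exact inv_ne_zero (pow_ne_zero _ hLr.ne')
  have hlen : ∀ y : (sfGeo d hL i).Site, (sfGeo d hL i).len y = 1 := fun y => by
    show (L : ℝ) ^ i.kk * ((L : ℝ) ^ i.kk)⁻¹ = 1
    exact mul_inv_cancel₀ (pow_ne_zero _ hLr.ne')
  refine etaRateIneqSite_opGeo_unit (g := sfGeo d hL i) (X := CvX d L i.m i.kk hL × ι) (blk := liftBlk (cvBlk d L i.m i.kk hL) ι)
    (foSiteAny d mm ι a hL α β j j' Xc Xf Dc Ec Df Ef i) hlen hη hLr (fun y y' => ?_) d' p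
  rw [rateWeight_unitTorusGeoS, rateWeight_unitTorusGeoS, max_self, foSiteAny_ker,
    show (sfGeo d hL i).dist y y' = tdistT (cvM d L i.m i.kk hL) y y' from rfl]
  set M := cvM d L i.m i.kk hL with hMdef
  set pp : B4.Idx (pbox M) (d + 1) × ι := ((⟨rep M y, rep_mem_pbox M y⟩, α), j) with hpp
  set qq : B4.Idx (pbox M) (d + 1) × ι := ((⟨rep M y', rep_mem_pbox M y'⟩, β), j') with hqq
  have hcd : cdist M ι pp qq = tdistT M y y' := by
    rw [cdist_eq, hpp, hqq]
    exact pdist_rep_rep M (one_le_M M) y y'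
  have hS := HSi pp qq
  rw [hcd] at hS
  have hE := Real.exp_nonneg (-(δS * tdistT M y y'))
  -- the amplitude against `t = (L^k)^{−1∕16}` (`K_X r_A, K_D r_A ≤ 1`, `t ≤ 1`)
  have hamp : C * (Kz * (KX * ((((L ^ i.kk : ℕ) : ℝ)) ^ (-(1 / 16 : ℝ))) +
      (KX * (c35 * (L : ℝ) ^ i.m * α₀) + KD * (c35 * (L : ℝ) ^ i.m * α₀) + KD * (c35 * (L : ℝ) ^ i.m * α₀)) * ((((L ^ i.kk : ℕ) : ℝ)) ^ (-(1 / 16 : ℝ))) +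
      KD * ((((L ^ i.kk : ℕ) : ℝ)) ^ (-(1 / 16 : ℝ))) + KD * ((((L ^ i.kk : ℕ) : ℝ)) ^ (-(1 / 16 : ℝ)))) + ((L ^ i.kk : ℕ) : ℝ)⁻¹)
      ≤ (C * (Kz * (KX + 3 + 2 * KD) + 1) + 1) * t := by
    rw [hθt]
    have h3 : (KX * (c35 * (L : ℝ) ^ i.m * α₀) + KD * (c35 * (L : ℝ) ^ i.m * α₀) + KD * (c35 * (L : ℝ) ^ i.m * α₀)) * t ≤ 3 * t :=
      mul_le_mul_of_nonneg_right (by linarith) ht0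
    have h4 : Kz * (KX * t + (KX * (c35 * (L : ℝ) ^ i.m * α₀) + KD * (c35 * (L : ℝ) ^ i.m * α₀) + KD * (c35 * (L : ℝ) ^ i.m * α₀)) * t + KD * t + KD * t) ≤
        Kz * (KX * t + 3 * t + KD * t + KD * t) := mul_le_mul_of_nonneg_left (by linarith) hKz.le
    calc C * (Kz * (KX * t + (KX * (c35 * (L : ℝ) ^ i.m * α₀) + KD * (c35 * (L : ℝ) ^ i.m * α₀) + KD * (c35 * (L : ℝ) ^ i.m * α₀)) * t + KD * t + KD * t) + ((L ^ i.kk : ℕ) : ℝ)⁻¹)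
        ≤ C * (Kz * (KX * t + 3 * t + KD * t + KD * t) + t) := mul_le_mul_of_nonneg_left (add_le_add h4 hinv) hC.le
      _ = (C * (Kz * (KX + 3 + 2 * KD) + 1)) * t := by ring
      _ ≤ (C * (Kz * (KX + 3 + 2 * KD) + 1) + 1) * t := mul_le_mul_of_nonneg_right (by linarith) ht0
  calc _ ≤ C * (Kz * (KX * ((((L ^ i.kk : ℕ) : ℝ)) ^ (-(1 / 16 : ℝ))) +
          (KX * (c35 * (L : ℝ) ^ i.m * α₀) + KD * (c35 * (L : ℝ) ^ i.m * α₀) + KD * (c35 * (L : ℝ) ^ i.m * α₀)) * ((((L ^ i.kk : ℕ) : ℝ)) ^ (-(1 / 16 : ℝ))) +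
          KD * ((((L ^ i.kk : ℕ) : ℝ)) ^ (-(1 / 16 : ℝ))) + KD * ((((L ^ i.kk : ℕ) : ℝ)) ^ (-(1 / 16 : ℝ)))) + ((L ^ i.kk : ℕ) : ℝ)⁻¹) * Real.exp (-(δS * tdistT M y y')) := hS
    _ ≤ ((C * (Kz * (KX + 3 + 2 * KD) + 1) + 1) * t) * Real.exp (-(δS * tdistT M y y')) := mul_le_mul_of_nonneg_right hamp hE
    _ = _ := by rw [ht_def]; ring

end SiteLayer


end Summit.QuantumFields.YangMills.BalabanUVNodes.N15.SiteLayerSf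

end
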